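import Summits.BirchSwinnertonDyer.BirchSwinnertonDyer.Theorems.ClassRecordThreeReg3CertModelsDefs
import Summits.BirchSwinnertonDyer.BirchSwinnertonDyer.Theorems.ClassRecordThreeRegCertRows64
import Summits.BirchSwinnertonDyer.BirchSwinnertonDyer.Theorems.ClassRecordThreeRegCertRows65
import Summits.BirchSwinnertonDyer.BirchSwinnertonDyer.Theorems.ClassRecordThreeRegCertRows66
import Summits.BirchSwinnertonDyer.BirchSwinnertonDyer.Theorems.ClassRecordThreeRegCertRows67
import Summits.BirchSwinnertonDyer.BirchSwinnertonDyer.Theorems.ClassRecordThreeRegCertRows68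
import Summits.BirchSwinnertonDyer.BirchSwinnertonDyer.Theorems.ClassRecordThreeRegCertRows69
import Summits.BirchSwinnertonDyer.BirchSwinnertonDyer.Theorems.ClassRecordThreeRegCertRows70
import Summits.BirchSwinnertonDyer.BirchSwinnertonDyer.Theorems.ClassRecordThreeRegCertRows71
import Summits.BirchSwinnertonDyer.BirchSwinnertonDyer.Theorems.ClassRecordThreeRegCertRows72
import Summits.BirchSwinnertonDyer.BirchSwinnertonDyer.Theorems.ClassRecordThreeRegCertRows73
import Summits.BirchSwinnertonDyer.BirchSwinnertonDyer.Theorems.ClassRecordThreeRegCertRows74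
import Summits.BirchSwinnertonDyer.BirchSwinnertonDyer.Theorems.ClassRecordThreeRegCertRows75
import Summits.BirchSwinnertonDyer.BirchSwinnertonDyer.Theorems.ClassRecordThreeRegCertRows76
import Summits.BirchSwinnertonDyer.BirchSwinnertonDyer.Theorems.ClassRecordThreeRegCertRows77
import Summits.BirchSwinnertonDyer.BirchSwinnertonDyer.Theorems.ClassRecordThreeRegCertRows79
import Summits.BirchSwinnertonDyer.BirchSwinnertonDyer.Theorems.ClassRecordThreeRegCertRows80
import Summits.BirchSwinnertonDyer.BirchSwinnertonDyer.Theorems.ClassRecordThreeRegCertRows81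
import Summits.BirchSwinnertonDyer.BirchSwinnertonDyer.Theorems.ClassRecordThreeRegCertRows82
import Summits.BirchSwinnertonDyer.BirchSwinnertonDyer.Theorems.ClassRecordThreeRegCertRows84
import Summits.BirchSwinnertonDyer.BirchSwinnertonDyer.Theorems.ClassRecordThreeRegCertRows85
import Summits.BirchSwinnertonDyer.BirchSwinnertonDyer.Theorems.ClassRecordThreeRegCertRows86
import Summits.BirchSwinnertonDyer.BirchSwinnertonDyer.Theorems.ClassRecordThreeRegCertRows87
import Summits.BirchSwinnertonDyer.BirchSwinnertonDyer.Theorems.ClassRecordThreeRegCertRows88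
import Summits.BirchSwinnertonDyer.BirchSwinnertonDyer.Theorems.ClassRecordThreeRegCertRows89
import Summits.BirchSwinnertonDyer.BirchSwinnertonDyer.Theorems.ClassRecordThreeRegCertRows90
import Summits.BirchSwinnertonDyer.BirchSwinnertonDyer.Theorems.ClassRecordThreeRegCertRows91
import Summits.BirchSwinnertonDyer.BirchSwinnertonDyer.Theorems.ClassRecordThreeRegCertRows92
import Summits.BirchSwinnertonDyer.BirchSwinnertonDyer.Theorems.ClassRecordThreeRegCertRows93
import Summits.BirchSwinnertonDyer.BirchSwinnertonDyer.Theorems.ClassRecordThreeRegCertRows94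
import Summits.BirchSwinnertonDyer.BirchSwinnertonDyer.Theorems.ClassRecordThreeRegCertRows95
import Summits.BirchSwinnertonDyer.BirchSwinnertonDyer.Theorems.ClassRecordThreeRegCertRows96
import Summits.BirchSwinnertonDyer.BirchSwinnertonDyer.Theorems.ClassRecordThreeRegCertRows97
import Summits.BirchSwinnertonDyer.BirchSwinnertonDyer.Theorems.ClassRecordThreeRegCertRows98
import Summits.BirchSwinnertonDyer.BirchSwinnertonDyer.Theorems.ClassRecordThreeRegCertRows99
import Summits.BirchSwinnertonDyer.BirchSwinnertonDyer.Theorems.ClassRecordThreeRegCertRows100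
import Summits.BirchSwinnertonDyer.BirchSwinnertonDyer.Theorems.ClassRecordThreeRegCertRows101
import Summits.BirchSwinnertonDyer.BirchSwinnertonDyer.Theorems.ClassRecordThreeRegCertRows102
import Summits.BirchSwinnertonDyer.BirchSwinnertonDyer.Theorems.ClassRecordThreeRegCertRows103
import HarnessLib

/-!
# Route `ClassRecordThree`, crux `SchneiderAtThree` (item 19106): the REG3CERT finite-table consumer, chunk 4 ∕ 4
# (cell `bsd-stepL`, seat `bsd-stepL-reg3-eng` g5; `--supports stmt-BirchSwinnertonDyer-19106`)

HONEST FRAMING: BSD is not proved by any of this; nothing here closes the crux; Schneider's non-degeneracy conjecture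
(barrier `PAdicHeightNondegeneracy`) is asserted NOWHERE; the theorem below is a FINITE conjunction of per-curve rung
theorems, one for each of the 180 models of `Reg3Cert.reg3certModels₄` (Cremona `488400cy1` … `311610bq1`), each of
which was already a kernel theorem modulo GZK (`Rows.rung_<label>` in `Theorems/ClassRecordThreeRegCertRows*.lean`). The proof walks the
list literal: `W ∈ a :: l ↔ W = a ∨ W ∈ l`, one row theorem per head. Theorems only (0 defs, 0 facts).
References: [SteinWuthrich2013] §4.2 and Conj. 4.1; [KolyvaginEulerSystems1990] Thm. A (GZK).
-/

open WeierstrassCurve Literature.NumberTheory.EllipticCurves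
  Literature.NumberTheory.EllipticCurves.Rank1Residual
  Summit.BirchSwinnertonDyer.Rank1Residual
  Summit.BirchSwinnertonDyer.Rank1Residual.X11b
  Summit.BirchSwinnertonDyer.Rank1Residual.X11b.RegMult

namespace Summit.BirchSwinnertonDyer.Rank1Residual.X11b.RegMult.Reg3Cert

/-- **REG3CERT rungs, chunk 4 ∕ 4.** For every globally minimal `W` among the 180 models of
`reg3certModels₄` (Cremona `488400cy1` … `311610bq1`): from the PUBLISHED fact GZK
(`rank_eq_analyticRank_of_analyticRank_le_one`), `ClassX11b W 3 → Ram W 3 → ¬ split(3) →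
ClassClosure.RegulatorNonvanishingAt W 3` — the matrix of crux `SchneiderAtThree` at that curve, by the row's kernel
certificate. A finite conjunction of ONE-curve theorems; nothing class-wide; closes nothing by itself.
[cite: SteinWuthrich2013, §4.2 and Conj. 4.1] [cite: KolyvaginEulerSystems1990, Thm. A] -/
theorem rung_of_mem_reg3certModels₄ (hGZK : rank_eq_analyticRank_of_analyticRank_le_one) (W : WeierstrassCurve ℚ)
    [W.IsElliptic] [W.IsGloballyMinimal] (hW : W ∈ reg3certModels₄) :
    ClassX11b W 3 → Ram W 3 → ¬ W.HasSplitMultiplicativeReductionAtPrime 3 →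
      ClassClosure.RegulatorNonvanishingAt W 3 := by
  unfold reg3certModels₄ at hW
  refine (List.mem_cons.mp hW).elim (fun h => Rows.rung_488400cy1 hGZK W h) fun hW => ?_  -- 488400cy1
  refine (List.mem_cons.mp hW).elim (fun h => Rows.rung_180642ca1 hGZK W h) fun hW => ?_  -- 180642ca1
  refine (List.mem_cons.mp hW).elim (fun h => Rows.rung_222456q1 hGZK W h) fun hW => ?_  -- 222456q1
  refine (List.mem_cons.mp hW).elim (fun h => Rows.rung_301476a1 hGZK W h) fun hW => ?_  -- 301476a1
  refine (List.mem_cons.mp hW).elim (fun h => Rows.rung_418470l1 hGZK W h) fun hW => ?_  -- 418470l1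
  refine (List.mem_cons.mp hW).elim (fun h => Rows.rung_457170b1 hGZK W h) fun hW => ?_  -- 457170b1
  refine (List.mem_cons.mp hW).elim (fun h => Rows.rung_497490m1 hGZK W h) fun hW => ?_  -- 497490m1
  refine (List.mem_cons.mp hW).elim (fun h => Rows.rung_265650et1 hGZK W h) fun hW => ?_  -- 265650et1
  refine (List.mem_cons.mp hW).elim (fun h => Rows.rung_126096a1 hGZK W h) fun hW => ?_  -- 126096a1
  refine (List.mem_cons.mp hW).elim (fun h => Rows.rung_164472bb1 hGZK W h) fun hW => ?_  -- 164472bb1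
  refine (List.mem_cons.mp hW).elim (fun h => Rows.rung_194880ha1 hGZK W h) fun hW => ?_  -- 194880ha1
  refine (List.mem_cons.mp hW).elim (fun h => Rows.rung_101010bk1 hGZK W h) fun hW => ?_  -- 101010bk1
  refine (List.mem_cons.mp hW).elim (fun h => Rows.rung_185640n1 hGZK W h) fun hW => ?_  -- 185640n1
  refine (List.mem_cons.mp hW).elim (fun h => Rows.rung_393900e1 hGZK W h) fun hW => ?_  -- 393900e1
  refine (List.mem_cons.mp hW).elim (fun h => Rows.rung_341880d1 hGZK W h) fun hW => ?_  -- 341880d1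
  refine (List.mem_cons.mp hW).elim (fun h => Rows.rung_380226b1 hGZK W h) fun hW => ?_  -- 380226b1
  refine (List.mem_cons.mp hW).elim (fun h => Rows.rung_429387y1 hGZK W h) fun hW => ?_  -- 429387y1
  refine (List.mem_cons.mp hW).elim (fun h => Rows.rung_150654z1 hGZK W h) fun hW => ?_  -- 150654z1
  refine (List.mem_cons.mp hW).elim (fun h => Rows.rung_253110b1 hGZK W h) fun hW => ?_  -- 253110b1
  refine (List.mem_cons.mp hW).elim (fun h => Rows.rung_316470bc1 hGZK W h) fun hW => ?_  -- 316470bc1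
  refine (List.mem_cons.mp hW).elim (fun h => Rows.rung_384540f1 hGZK W h) fun hW => ?_  -- 384540f1
  refine (List.mem_cons.mp hW).elim (fun h => Rows.rung_465738o1 hGZK W h) fun hW => ?_  -- 465738o1
  refine (List.mem_cons.mp hW).elim (fun h => Rows.rung_450240co1 hGZK W h) fun hW => ?_  -- 450240co1
  refine (List.mem_cons.mp hW).elim (fun h => Rows.rung_224790p1 hGZK W h) fun hW => ?_  -- 224790p1
  refine (List.mem_cons.mp hW).elim (fun h => Rows.rung_458400y1 hGZK W h) fun hW => ?_  -- 458400y1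
  refine (List.mem_cons.mp hW).elim (fun h => Rows.rung_253662d1 hGZK W h) fun hW => ?_  -- 253662d1
  refine (List.mem_cons.mp hW).elim (fun h => Rows.rung_334950n1 hGZK W h) fun hW => ?_  -- 334950n1
  refine (List.mem_cons.mp hW).elim (fun h => Rows.rung_339240e1 hGZK W h) fun hW => ?_  -- 339240e1
  refine (List.mem_cons.mp hW).elim (fun h => Rows.rung_381930n1 hGZK W h) fun hW => ?_  -- 381930n1
  refine (List.mem_cons.mp hW).elim (fun h => Rows.rung_447450a1 hGZK W h) fun hW => ?_  -- 447450a1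
  refine (List.mem_cons.mp hW).elim (fun h => Rows.rung_473802g1 hGZK W h) fun hW => ?_  -- 473802g1
  refine (List.mem_cons.mp hW).elim (fun h => Rows.rung_157080cm1 hGZK W h) fun hW => ?_  -- 157080cm1
  refine (List.mem_cons.mp hW).elim (fun h => Rows.rung_259350u1 hGZK W h) fun hW => ?_  -- 259350u1
  refine (List.mem_cons.mp hW).elim (fun h => Rows.rung_351120bb1 hGZK W h) fun hW => ?_  -- 351120bb1
  refine (List.mem_cons.mp hW).elim (fun h => Rows.rung_466779a1 hGZK W h) fun hW => ?_  -- 466779a1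
  refine (List.mem_cons.mp hW).elim (fun h => Rows.rung_139515g1 hGZK W h) fun hW => ?_  -- 139515g1
  refine (List.mem_cons.mp hW).elim (fun h => Rows.rung_351120x1 hGZK W h) fun hW => ?_  -- 351120x1
  refine (List.mem_cons.mp hW).elim (fun h => Rows.rung_400890b1 hGZK W h) fun hW => ?_  -- 400890b1
  refine (List.mem_cons.mp hW).elim (fun h => Rows.rung_480459d1 hGZK W h) fun hW => ?_  -- 480459d1
  refine (List.mem_cons.mp hW).elim (fun h => Rows.rung_493950l1 hGZK W h) fun hW => ?_  -- 493950l1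
  refine (List.mem_cons.mp hW).elim (fun h => Rows.rung_266910bt1 hGZK W h) fun hW => ?_  -- 266910bt1
  refine (List.mem_cons.mp hW).elim (fun h => Rows.rung_296322i1 hGZK W h) fun hW => ?_  -- 296322i1
  refine (List.mem_cons.mp hW).elim (fun h => Rows.rung_224112bc1 hGZK W h) fun hW => ?_  -- 224112bc1
  refine (List.mem_cons.mp hW).elim (fun h => Rows.rung_167790w1 hGZK W h) fun hW => ?_  -- 167790w1
  refine (List.mem_cons.mp hW).elim (fun h => Rows.rung_192270s1 hGZK W h) fun hW => ?_  -- 192270s1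
  refine (List.mem_cons.mp hW).elim (fun h => Rows.rung_205062t1 hGZK W h) fun hW => ?_  -- 205062t1
  refine (List.mem_cons.mp hW).elim (fun h => Rows.rung_462300l1 hGZK W h) fun hW => ?_  -- 462300l1
  refine (List.mem_cons.mp hW).elim (fun h => Rows.rung_438906c1 hGZK W h) fun hW => ?_  -- 438906c1
  refine (List.mem_cons.mp hW).elim (fun h => Rows.rung_188904i1 hGZK W h) fun hW => ?_  -- 188904i1
  refine (List.mem_cons.mp hW).elim (fun h => Rows.rung_431754a1 hGZK W h) fun hW => ?_  -- 431754a1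
  refine (List.mem_cons.mp hW).elim (fun h => Rows.rung_499290g1 hGZK W h) fun hW => ?_  -- 499290g1
  refine (List.mem_cons.mp hW).elim (fun h => Rows.rung_322770l1 hGZK W h) fun hW => ?_  -- 322770l1
  refine (List.mem_cons.mp hW).elim (fun h => Rows.rung_212784q1 hGZK W h) fun hW => ?_  -- 212784q1
  refine (List.mem_cons.mp hW).elim (fun h => Rows.rung_150150fh1 hGZK W h) fun hW => ?_  -- 150150fh1
  refine (List.mem_cons.mp hW).elim (fun h => Rows.rung_441672a1 hGZK W h) fun hW => ?_  -- 441672a1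
  refine (List.mem_cons.mp hW).elim (fun h => Rows.rung_299280m1 hGZK W h) fun hW => ?_  -- 299280m1
  refine (List.mem_cons.mp hW).elim (fun h => Rows.rung_485070b1 hGZK W h) fun hW => ?_  -- 485070b1
  refine (List.mem_cons.mp hW).elim (fun h => Rows.rung_198660r1 hGZK W h) fun hW => ?_  -- 198660r1
  refine (List.mem_cons.mp hW).elim (fun h => Rows.rung_250674b1 hGZK W h) fun hW => ?_  -- 250674b1
  refine (List.mem_cons.mp hW).elim (fun h => Rows.rung_374358f1 hGZK W h) fun hW => ?_  -- 374358f1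
  refine (List.mem_cons.mp hW).elim (fun h => Rows.rung_170940r1 hGZK W h) fun hW => ?_  -- 170940r1
  refine (List.mem_cons.mp hW).elim (fun h => Rows.rung_182910bb1 hGZK W h) fun hW => ?_  -- 182910bb1
  refine (List.mem_cons.mp hW).elim (fun h => Rows.rung_384312c1 hGZK W h) fun hW => ?_  -- 384312c1
  refine (List.mem_cons.mp hW).elim (fun h => Rows.rung_369474q1 hGZK W h) fun hW => ?_  -- 369474q1
  refine (List.mem_cons.mp hW).elim (fun h => Rows.rung_347844a1 hGZK W h) fun hW => ?_  -- 347844a1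
  refine (List.mem_cons.mp hW).elim (fun h => Rows.rung_481182a1 hGZK W h) fun hW => ?_  -- 481182a1
  refine (List.mem_cons.mp hW).elim (fun h => Rows.rung_457950bu1 hGZK W h) fun hW => ?_  -- 457950bu1
  refine (List.mem_cons.mp hW).elim (fun h => Rows.rung_495726n1 hGZK W h) fun hW => ?_  -- 495726n1
  refine (List.mem_cons.mp hW).elim (fun h => Rows.rung_496938c1 hGZK W h) fun hW => ?_  -- 496938c1
  refine (List.mem_cons.mp hW).elim (fun h => Rows.rung_431340k1 hGZK W h) fun hW => ?_  -- 431340k1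
  refine (List.mem_cons.mp hW).elim (fun h => Rows.rung_255990w1 hGZK W h) fun hW => ?_  -- 255990w1
  refine (List.mem_cons.mp hW).elim (fun h => Rows.rung_460920b1 hGZK W h) fun hW => ?_  -- 460920b1
  refine (List.mem_cons.mp hW).elim (fun h => Rows.rung_227766l1 hGZK W h) fun hW => ?_  -- 227766l1
  refine (List.mem_cons.mp hW).elim (fun h => Rows.rung_412224u1 hGZK W h) fun hW => ?_  -- 412224u1
  refine (List.mem_cons.mp hW).elim (fun h => Rows.rung_205590bz1 hGZK W h) fun hW => ?_  -- 205590bz1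
  refine (List.mem_cons.mp hW).elim (fun h => Rows.rung_457170e1 hGZK W h) fun hW => ?_  -- 457170e1
  refine (List.mem_cons.mp hW).elim (fun h => Rows.rung_308490cb1 hGZK W h) fun hW => ?_  -- 308490cb1
  refine (List.mem_cons.mp hW).elim (fun h => Rows.rung_462630a1 hGZK W h) fun hW => ?_  -- 462630a1
  refine (List.mem_cons.mp hW).elim (fun h => Rows.rung_281010h1 hGZK W h) fun hW => ?_  -- 281010h1
  refine (List.mem_cons.mp hW).elim (fun h => Rows.rung_357258b1 hGZK W h) fun hW => ?_  -- 357258b1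
  refine (List.mem_cons.mp hW).elim (fun h => Rows.rung_471030i1 hGZK W h) fun hW => ?_  -- 471030i1
  refine (List.mem_cons.mp hW).elim (fun h => Rows.rung_330078j1 hGZK W h) fun hW => ?_  -- 330078j1
  refine (List.mem_cons.mp hW).elim (fun h => Rows.rung_177072bc1 hGZK W h) fun hW => ?_  -- 177072bc1
  refine (List.mem_cons.mp hW).elim (fun h => Rows.rung_445782a1 hGZK W h) fun hW => ?_  -- 445782a1
  refine (List.mem_cons.mp hW).elim (fun h => Rows.rung_118590s1 hGZK W h) fun hW => ?_  -- 118590s1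
  refine (List.mem_cons.mp hW).elim (fun h => Rows.rung_477120di1 hGZK W h) fun hW => ?_  -- 477120di1
  refine (List.mem_cons.mp hW).elim (fun h => Rows.rung_427350cm1 hGZK W h) fun hW => ?_  -- 427350cm1
  refine (List.mem_cons.mp hW).elim (fun h => Rows.rung_171570bj1 hGZK W h) fun hW => ?_  -- 171570bj1
  refine (List.mem_cons.mp hW).elim (fun h => Rows.rung_246561d1 hGZK W h) fun hW => ?_  -- 246561d1
  refine (List.mem_cons.mp hW).elim (fun h => Rows.rung_477192b1 hGZK W h) fun hW => ?_  -- 477192b1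
  refine (List.mem_cons.mp hW).elim (fun h => Rows.rung_111930bx1 hGZK W h) fun hW => ?_  -- 111930bx1
  refine (List.mem_cons.mp hW).elim (fun h => Rows.rung_400890z1 hGZK W h) fun hW => ?_  -- 400890z1
  refine (List.mem_cons.mp hW).elim (fun h => Rows.rung_255360bf1 hGZK W h) fun hW => ?_  -- 255360bf1
  refine (List.mem_cons.mp hW).elim (fun h => Rows.rung_186690bj1 hGZK W h) fun hW => ?_  -- 186690bj1
  refine (List.mem_cons.mp hW).elim (fun h => Rows.rung_408918c1 hGZK W h) fun hW => ?_  -- 408918c1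
  refine (List.mem_cons.mp hW).elim (fun h => Rows.rung_124320bo1 hGZK W h) fun hW => ?_  -- 124320bo1
  refine (List.mem_cons.mp hW).elim (fun h => Rows.rung_444270f1 hGZK W h) fun hW => ?_  -- 444270f1
  refine (List.mem_cons.mp hW).elim (fun h => Rows.rung_446160eb1 hGZK W h) fun hW => ?_  -- 446160eb1
  refine (List.mem_cons.mp hW).elim (fun h => Rows.rung_250734u1 hGZK W h) fun hW => ?_  -- 250734u1
  refine (List.mem_cons.mp hW).elim (fun h => Rows.rung_488130k1 hGZK W h) fun hW => ?_  -- 488130k1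
  refine (List.mem_cons.mp hW).elim (fun h => Rows.rung_482160do1 hGZK W h) fun hW => ?_  -- 482160do1
  refine (List.mem_cons.mp hW).elim (fun h => Rows.rung_179760ce1 hGZK W h) fun hW => ?_  -- 179760ce1
  refine (List.mem_cons.mp hW).elim (fun h => Rows.rung_234210o1 hGZK W h) fun hW => ?_  -- 234210o1
  refine (List.mem_cons.mp hW).elim (fun h => Rows.rung_458490b1 hGZK W h) fun hW => ?_  -- 458490b1
  refine (List.mem_cons.mp hW).elim (fun h => Rows.rung_139965d1 hGZK W h) fun hW => ?_  -- 139965d1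
  refine (List.mem_cons.mp hW).elim (fun h => Rows.rung_466050bs1 hGZK W h) fun hW => ?_  -- 466050bs1
  refine (List.mem_cons.mp hW).elim (fun h => Rows.rung_469650h1 hGZK W h) fun hW => ?_  -- 469650h1
  refine (List.mem_cons.mp hW).elim (fun h => Rows.rung_301920i1 hGZK W h) fun hW => ?_  -- 301920i1
  refine (List.mem_cons.mp hW).elim (fun h => Rows.rung_307230bn1 hGZK W h) fun hW => ?_  -- 307230bn1
  refine (List.mem_cons.mp hW).elim (fun h => Rows.rung_367296c1 hGZK W h) fun hW => ?_  -- 367296c1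
  refine (List.mem_cons.mp hW).elim (fun h => Rows.rung_185790o1 hGZK W h) fun hW => ?_  -- 185790o1
  refine (List.mem_cons.mp hW).elim (fun h => Rows.rung_383910a1 hGZK W h) fun hW => ?_  -- 383910a1
  refine (List.mem_cons.mp hW).elim (fun h => Rows.rung_260130bb1 hGZK W h) fun hW => ?_  -- 260130bb1
  refine (List.mem_cons.mp hW).elim (fun h => Rows.rung_428736d1 hGZK W h) fun hW => ?_  -- 428736d1
  refine (List.mem_cons.mp hW).elim (fun h => Rows.rung_366366v1 hGZK W h) fun hW => ?_  -- 366366v1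
  refine (List.mem_cons.mp hW).elim (fun h => Rows.rung_397110be1 hGZK W h) fun hW => ?_  -- 397110be1
  refine (List.mem_cons.mp hW).elim (fun h => Rows.rung_412230j1 hGZK W h) fun hW => ?_  -- 412230j1
  refine (List.mem_cons.mp hW).elim (fun h => Rows.rung_429450l1 hGZK W h) fun hW => ?_  -- 429450l1
  refine (List.mem_cons.mp hW).elim (fun h => Rows.rung_441840g1 hGZK W h) fun hW => ?_  -- 441840g1
  refine (List.mem_cons.mp hW).elim (fun h => Rows.rung_164850bb1 hGZK W h) fun hW => ?_  -- 164850bb1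
  refine (List.mem_cons.mp hW).elim (fun h => Rows.rung_414150a1 hGZK W h) fun hW => ?_  -- 414150a1
  refine (List.mem_cons.mp hW).elim (fun h => Rows.rung_125034x1 hGZK W h) fun hW => ?_  -- 125034x1
  refine (List.mem_cons.mp hW).elim (fun h => Rows.rung_115230n1 hGZK W h) fun hW => ?_  -- 115230n1
  refine (List.mem_cons.mp hW).elim (fun h => Rows.rung_486330bb1 hGZK W h) fun hW => ?_  -- 486330bb1
  refine (List.mem_cons.mp hW).elim (fun h => Rows.rung_198030x1 hGZK W h) fun hW => ?_  -- 198030x1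
  refine (List.mem_cons.mp hW).elim (fun h => Rows.rung_346710q1 hGZK W h) fun hW => ?_  -- 346710q1
  refine (List.mem_cons.mp hW).elim (fun h => Rows.rung_368490p1 hGZK W h) fun hW => ?_  -- 368490p1
  refine (List.mem_cons.mp hW).elim (fun h => Rows.rung_215070v1 hGZK W h) fun hW => ?_  -- 215070v1
  refine (List.mem_cons.mp hW).elim (fun h => Rows.rung_482160ct1 hGZK W h) fun hW => ?_  -- 482160ct1
  refine (List.mem_cons.mp hW).elim (fun h => Rows.rung_307428a1 hGZK W h) fun hW => ?_  -- 307428a1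
  refine (List.mem_cons.mp hW).elim (fun h => Rows.rung_395430ce1 hGZK W h) fun hW => ?_  -- 395430ce1
  refine (List.mem_cons.mp hW).elim (fun h => Rows.rung_235326m1 hGZK W h) fun hW => ?_  -- 235326m1
  refine (List.mem_cons.mp hW).elim (fun h => Rows.rung_281274b1 hGZK W h) fun hW => ?_  -- 281274b1
  refine (List.mem_cons.mp hW).elim (fun h => Rows.rung_225654g1 hGZK W h) fun hW => ?_  -- 225654g1
  refine (List.mem_cons.mp hW).elim (fun h => Rows.rung_487830bu1 hGZK W h) fun hW => ?_  -- 487830bu1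
  refine (List.mem_cons.mp hW).elim (fun h => Rows.rung_427350dn1 hGZK W h) fun hW => ?_  -- 427350dn1
  refine (List.mem_cons.mp hW).elim (fun h => Rows.rung_286350n1 hGZK W h) fun hW => ?_  -- 286350n1
  refine (List.mem_cons.mp hW).elim (fun h => Rows.rung_436650cm1 hGZK W h) fun hW => ?_  -- 436650cm1
  refine (List.mem_cons.mp hW).elim (fun h => Rows.rung_441840y1 hGZK W h) fun hW => ?_  -- 441840y1
  refine (List.mem_cons.mp hW).elim (fun h => Rows.rung_317730p1 hGZK W h) fun hW => ?_  -- 317730p1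
  refine (List.mem_cons.mp hW).elim (fun h => Rows.rung_498525ca1 hGZK W h) fun hW => ?_  -- 498525ca1
  refine (List.mem_cons.mp hW).elim (fun h => Rows.rung_329640l1 hGZK W h) fun hW => ?_  -- 329640l1
  refine (List.mem_cons.mp hW).elim (fun h => Rows.rung_326190k1 hGZK W h) fun hW => ?_  -- 326190k1
  refine (List.mem_cons.mp hW).elim (fun h => Rows.rung_213180bb1 hGZK W h) fun hW => ?_  -- 213180bb1
  refine (List.mem_cons.mp hW).elim (fun h => Rows.rung_106590l1 hGZK W h) fun hW => ?_  -- 106590l1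
  refine (List.mem_cons.mp hW).elim (fun h => Rows.rung_395430cj1 hGZK W h) fun hW => ?_  -- 395430cj1
  refine (List.mem_cons.mp hW).elim (fun h => Rows.rung_397110bd1 hGZK W h) fun hW => ?_  -- 397110bd1
  refine (List.mem_cons.mp hW).elim (fun h => Rows.rung_350526h1 hGZK W h) fun hW => ?_  -- 350526h1
  refine (List.mem_cons.mp hW).elim (fun h => Rows.rung_473802d1 hGZK W h) fun hW => ?_  -- 473802d1
  refine (List.mem_cons.mp hW).elim (fun h => Rows.rung_227370v1 hGZK W h) fun hW => ?_  -- 227370v1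
  refine (List.mem_cons.mp hW).elim (fun h => Rows.rung_402150bh1 hGZK W h) fun hW => ?_  -- 402150bh1
  refine (List.mem_cons.mp hW).elim (fun h => Rows.rung_291270k1 hGZK W h) fun hW => ?_  -- 291270k1
  refine (List.mem_cons.mp hW).elim (fun h => Rows.rung_198030bf1 hGZK W h) fun hW => ?_  -- 198030bf1
  refine (List.mem_cons.mp hW).elim (fun h => Rows.rung_425850bq1 hGZK W h) fun hW => ?_  -- 425850bq1
  refine (List.mem_cons.mp hW).elim (fun h => Rows.rung_331170g1 hGZK W h) fun hW => ?_  -- 331170g1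
  refine (List.mem_cons.mp hW).elim (fun h => Rows.rung_283668a1 hGZK W h) fun hW => ?_  -- 283668a1
  refine (List.mem_cons.mp hW).elim (fun h => Rows.rung_489090bm1 hGZK W h) fun hW => ?_  -- 489090bm1
  refine (List.mem_cons.mp hW).elim (fun h => Rows.rung_344190c1 hGZK W h) fun hW => ?_  -- 344190c1
  refine (List.mem_cons.mp hW).elim (fun h => Rows.rung_321594y1 hGZK W h) fun hW => ?_  -- 321594y1
  refine (List.mem_cons.mp hW).elim (fun h => Rows.rung_338352ba1 hGZK W h) fun hW => ?_  -- 338352ba1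
  refine (List.mem_cons.mp hW).elim (fun h => Rows.rung_414150f1 hGZK W h) fun hW => ?_  -- 414150f1
  refine (List.mem_cons.mp hW).elim (fun h => Rows.rung_466395o1 hGZK W h) fun hW => ?_  -- 466395o1
  refine (List.mem_cons.mp hW).elim (fun h => Rows.rung_441870bc1 hGZK W h) fun hW => ?_  -- 441870bc1
  refine (List.mem_cons.mp hW).elim (fun h => Rows.rung_482898k1 hGZK W h) fun hW => ?_  -- 482898k1
  refine (List.mem_cons.mp hW).elim (fun h => Rows.rung_345030z1 hGZK W h) fun hW => ?_  -- 345030z1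
  refine (List.mem_cons.mp hW).elim (fun h => Rows.rung_307230bs1 hGZK W h) fun hW => ?_  -- 307230bs1
  refine (List.mem_cons.mp hW).elim (fun h => Rows.rung_455070t1 hGZK W h) fun hW => ?_  -- 455070t1
  refine (List.mem_cons.mp hW).elim (fun h => Rows.rung_487713b1 hGZK W h) fun hW => ?_  -- 487713b1
  refine (List.mem_cons.mp hW).elim (fun h => Rows.rung_89778i1 hGZK W h) fun hW => ?_  -- 89778i1
  refine (List.mem_cons.mp hW).elim (fun h => Rows.rung_187530bt1 hGZK W h) fun hW => ?_  -- 187530bt1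
  refine (List.mem_cons.mp hW).elim (fun h => Rows.rung_274560be1 hGZK W h) fun hW => ?_  -- 274560be1
  refine (List.mem_cons.mp hW).elim (fun h => Rows.rung_283296a1 hGZK W h) fun hW => ?_  -- 283296a1
  refine (List.mem_cons.mp hW).elim (fun h => Rows.rung_447810i1 hGZK W h) fun hW => ?_  -- 447810i1
  refine (List.mem_cons.mp hW).elim (fun h => Rows.rung_399840cw1 hGZK W h) fun hW => ?_  -- 399840cw1
  refine (List.mem_cons.mp hW).elim (fun h => Rows.rung_174270y1 hGZK W h) fun hW => ?_  -- 174270y1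
  refine (List.mem_cons.mp hW).elim (fun h => Rows.rung_301665y1 hGZK W h) fun hW => ?_  -- 301665y1
  refine (List.mem_cons.mp hW).elim (fun h => Rows.rung_462630j1 hGZK W h) fun hW => ?_  -- 462630j1
  refine (List.mem_cons.mp hW).elim (fun h => Rows.rung_137310o1 hGZK W h) fun hW => ?_  -- 137310o1
  refine (List.mem_cons.mp hW).elim (fun h => Rows.rung_195888cg1 hGZK W h) fun hW => ?_  -- 195888cg1
  refine (List.mem_cons.mp hW).elim (fun h => Rows.rung_311610bq1 hGZK W h) fun hW => ?_  -- 311610bq1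
  exact nomatch hW

end Summit.BirchSwinnertonDyer.Rank1Residual.X11b.RegMult.Reg3Cert
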